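/- Copyright: the b2b-balaban cell (near-miss cell 7), T⁴-continuum fan-out; row NE7b CRUX team (2), seat
t4-ne7b-formalise-leaf-02 (gen 31) — the E-side (key readings) part of the row OWNER's INTERFACE REQUEST NE7b IR-49-1
«THE FIBRE DECORATION» (RULING R-OWNER-49-1 (e), `CLAIMS.log` l.33479; SPEC v0∕v0.1 `CLAIMS.log` l.33613, §4 «what the
E-side owes for (ρ1)»; `HOME/INBOX.md` l.12792), part 3 of 3.  Released under the licence of the surrounding project. -/
import Summits.QuantumFields.BalabanUV.T4Continuum.Support.HistoryBankingFibreDecorWeighted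
import Summits.QuantumFields.BalabanUV.T4Continuum.Support.B16HistoryIndexedFamily

/-!
# IR-49-1 «THE FIBRE DECORATION», KEY SIDE (3∕3): the slice of a term of (1.72)'s index, the slice set met in a key
fibre, the reduction of the joint injectivity to the history pair, and the junctions on that index

Summits-side support leaf of the T⁴-continuum cell (rung (B)+1 on a FINITE torus only; NOT infinite volume, NOT the
mass gap, NOT the Clay statement; NOT a proof of the spine estimate NE7b — the cell's OWN estimate, NOT PRINTED, NOT
PROVED).  [folklore] `Sigma`-type bookkeeping over M2-A's K-uniform index (`B16HistoryIndexedFamily`: `HIndex.Idx I =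
Σ K, Σ a, HZ × HL × HC`, `HIndex.termSet`), the fibre of the key map (`T4LiveClassFibration.fibre`), the owner's S25
junction (`HistoryBankingFibreResum.fibreMass_of_decoration`) and parts 1∕2 (`HistoryBankingFibreDecorKeys.decG`,
`fibreMass_of_genDecoration`; `HistoryBankingFibreDecorWeighted.fibreMass_of_genDecorationW`); no `structure`, no
`[cite:]` tag, nothing printed asserted, no `Prop` fact minted, zero `sorry`.  B16 = [Balaban1989LargeFieldII] is a
manuscript UNDER AUDIT; (1.71)∕(1.72) pp. 378–379 are quoted as LOCATORS of hypothesis SHAPES only.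

WHY.  SPEC IR-49-1 §2 displays, for the (ρ1) decoration of the key fibre, a slice `slice K τ ∈ Csl K k` and the JOINT
injectivity `hinj : slice K τ = slice K τ' → (∀ w ∈ k, dec K τ w = dec K τ' w) → τ = τ'`; §4 asks the E-side WHICH data
of M1's index `(a, h, ℓ, c)` these read.  On M2-A's index the slice is CANONICAL — a term `τ = ⟨K, a, (h, ℓ, c)⟩` of
`termSet I K` slices to `⟨K, a, c⟩` (cutoff, outer summand `a = (Z_K, {Y_i})`, curly summand `c`), the slice set of a
class is the image of its fibre (so SPEC's `hsl` is FREE) — and the injectivity display REDUCES to the one datum M1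
keeps abstract: «at fixed `a` and `c`, the HISTORY PAIR `(h, ℓ) ∈ HZs a × HYs a` — the admissible sequence of `Z_K`
and the sub-histories inside the `Y_i`, (1.71)∕(1.72) — is determined, member by member on the key, by the
decorations».  Since
`HZ`∕`HL` are opaque types of `B16HistoryIndexedRepr.HIndex`, the map `dec` itself cannot be defined at this level and
stays a DISPLAY of the custodian's bundle (SPEC §4's expected outcome, honest); what IS kernel is the slice, the slice
set, and that the displayed injectivity need only speak of the history pair.

WHAT.  §1 `SIdx I` (slice index type), `sliceOf`, `sliceOf_mk`, `eq_of_mem_termSet` (a term of `termSet I K` is an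
explicit triple at cutoff `K`), `sliceOf_eq_iff`, `CslOf` (the slice set met in a key fibre), `sliceOf_mem_CslOf`
(SPEC's `hsl`, free), `mem_CslOf`, **`hinj_of_histPair`** (THE REDUCTION).  §2 the junctions on M2-A's index with
`slice := sliceOf`, `Csl := CslOf`: **`fibreMass_of_decoration_idx`** (any currency `u`, abstract `Dec` — SPEC's
`hρ_of_indexDecor` field for field), **`fibreMass_of_genDecoration_idx`** (crude currency, `Dec := decG`, `u := 1`,
(ρ3) from the per-event letters on the members' events) and **`fibreMass_of_genDecorationW_idx`** (weighted currency,
`u w := nmass (μ w)`); all three conclude LITERALLY `∑ τ ∈ fibre kmem (termSet I) K k, dmass τ ≤ W * MULTOf φ k`.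

HONEST SCOPE.  Bookkeeping over OUR carriers; the READING (ρ1) (`dec`, `hmem`, the reduced `hinj`) and the envelope
(ρ2) (`v`, `hW`, `hfac`) remain hypotheses with locators; (ρ3) kernel modulo FIBRE-1's letters (parts 1∕2).  BY-NAME
EFFECT ON THE WALL: NONE by this file alone (the custodian's `IndexDecor` ∕ record twin replace `hρ`; these are the
E-side suppliers they instantiate).  NE7b NOT PRINTED ∕ NOT PROVED; spine 0∕9.  HONEST DEPENDENCY (cell): continuum YM
on T⁴ ⇐ BetaPertH ∧ nine spine estimates (0/9 proved); BetaPertH ⇐ (D1) ∧ (D4) ∧ CAP+tail; G-an2-4 gates asym, D1 and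
NE2/3/4.  This file changes none of it.
-/

open Finset
open Literature.MathematicalPhysics.QuantumFieldTheory.Balaban1983to89
open T4PersistenceDictionary T4LiveClassFibration
open Summit.QuantumFields.BalabanUV.T4Continuum.HistoryPriceNodeSum
open Summit.QuantumFields.BalabanUV.T4Continuum.HistoryPriceKeys
open Summit.QuantumFields.BalabanUV.T4Continuum.HistoryBankingFibreResum
open Summit.QuantumFields.BalabanUV.T4Continuum.HistoryBankingFibreResumWeighted
open Summit.QuantumFields.BalabanUV.T4Continuum.HistoryBankingFibreDecorKeys
open Summit.QuantumFields.BalabanUV.T4Continuum.HistoryBankingFibreDecorWeighted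
open Summit.QuantumFields.BalabanUV.T4Continuum.B16HistoryIndexedRepr

namespace Summit.QuantumFields.BalabanUV.T4Continuum.HistoryBankingFibreDecorSlice

noncomputable section

/-! ## §1 The slice of a term, the slice set met in a key fibre, and the reduced injectivity -/

section Index

variable {DomK : ℕ → Type*} (I : (K : ℕ) → HIndex (DomK K))

/-- **THE SLICE INDEX TYPE**: (cutoff, outer summand, curly summand). [folklore] -/
abbrev SIdx : Type _ := Σ K, Σ _ : (I K).Adm, (I K).HC

/-- **THE SLICE OF A TERM** `⟨K, a, (h, ℓ, c)⟩ ↦ ⟨K, a, c⟩`: what is left of (1.72)'s index when the history pair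
`(h, ℓ)` — the admissible sequence of `Z_K` and the sub-histories inside the `Y_i` — is set aside. [folklore] -/
def sliceOf : HIndex.Idx I → SIdx I
  | ⟨K, a, (_, _, c)⟩ => ⟨K, a, c⟩

/-- the slice of an explicit term [folklore] -/
@[simp] theorem sliceOf_mk (K : ℕ) (a : (I K).Adm) (h : (I K).HZ) (l : (I K).HL) (c : (I K).HC) :
    sliceOf I ⟨K, a, (h, l, c)⟩ = ⟨K, a, c⟩ := rfl

variable {I}
variable {ω : Type*} [DecidableEq ω]

omit [DecidableEq ω] in
/-- **A TERM OF `termSet I K` IS AN EXPLICIT TRIPLE AT CUTOFF `K`**. [folklore] -/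
theorem eq_of_mem_termSet {K : ℕ} {τ : HIndex.Idx I} (hτ : τ ∈ HIndex.termSet I K) :
    ∃ (a : (I K).Adm) (h : (I K).HZ) (l : (I K).HL) (c : (I K).HC),
      (h, l, c) ∈ (I K).LIdx a ∧ τ = ⟨K, a, (h, l, c)⟩ := by
  obtain ⟨⟨a, h, l, c⟩, hp, hpe⟩ := Finset.mem_map.mp hτ
  exact ⟨a, h, l, c, (Finset.mem_sigma.mp hp).2, hpe.symm⟩

omit [DecidableEq ω] in
/-- two terms at one cutoff have the same slice iff their outer and curly summands agree [folklore] -/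
theorem sliceOf_eq_iff {K : ℕ} {a a' : (I K).Adm} {h h' : (I K).HZ} {l l' : (I K).HL} {c c' : (I K).HC} :
    sliceOf I ⟨K, a, (h, l, c)⟩ = sliceOf I ⟨K, a', (h', l', c')⟩ ↔ a = a' ∧ c = c' := by
  rw [sliceOf_mk, sliceOf_mk]
  constructor
  · intro hs
    have h2 := (Sigma.mk.inj_iff.1 hs).2
    have h3 := Sigma.mk.inj_iff.1 (eq_of_heq h2)
    exact ⟨h3.1, eq_of_heq h3.2⟩
  · rintro ⟨rfl, rfl⟩
    rfl

variable (I) in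
/-- **THE SLICE SET MET IN A KEY FIBRE** (SPEC's `Csl K k`; with it the display `hsl` is free). [folklore] -/
def CslOf (kmem : ℕ → HIndex.Idx I → Finset ω) (K : ℕ) (k : Finset ω) : Finset (SIdx I) := by
  classical exact (fibre kmem (HIndex.termSet I) K k).image (sliceOf I)

/-- **SPEC's `hsl` IS FREE**: the slice of a fibre term lies in the fibre's slice set. [folklore] -/
theorem sliceOf_mem_CslOf {kmem : ℕ → HIndex.Idx I → Finset ω} {K : ℕ} {k : Finset ω}
    {τ : HIndex.Idx I} (hτ : τ ∈ fibre kmem (HIndex.termSet I) K k) : sliceOf I τ ∈ CslOf I kmem K k := by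
  classical
  unfold CslOf
  exact Finset.mem_image_of_mem _ hτ

/-- membership in the slice set [folklore] -/
theorem mem_CslOf {kmem : ℕ → HIndex.Idx I → Finset ω} {K : ℕ} {k : Finset ω} {s : SIdx I} :
    s ∈ CslOf I kmem K k ↔ ∃ τ ∈ fibre kmem (HIndex.termSet I) K k, sliceOf I τ = s := by
  classical
  unfold CslOf
  exact Finset.mem_image

/-- **THE REDUCTION OF SPEC's JOINT INJECTIVITY `hinj` TO THE HISTORY PAIR** (slice `:= sliceOf`): it suffices that, at
every fixed outer summand `a` and curly summand `c` of the cutoff, the HISTORY PAIR `(h, ℓ)` of a fibre term be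
determined, member by member on the key, by its decorations — (1.71)∕(1.72)'s reading «the index IS (outer summand,
per-component admissible sequences, curly summand)» stated on exactly the datum M1 leaves abstract. [folklore] -/
theorem hinj_of_histPair {δ : Type*} (kmem : ℕ → HIndex.Idx I → Finset ω) (K : ℕ) (k : Finset ω)
    (dec : HIndex.Idx I → ω → δ)
    (hp : ∀ (a : (I K).Adm) (c : (I K).HC) (p p' : (I K).HZ × (I K).HL),
      (⟨K, a, (p.1, p.2, c)⟩ : HIndex.Idx I) ∈ fibre kmem (HIndex.termSet I) K k →
      (⟨K, a, (p'.1, p'.2, c)⟩ : HIndex.Idx I) ∈ fibre kmem (HIndex.termSet I) K k →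
      (∀ w ∈ k, dec ⟨K, a, (p.1, p.2, c)⟩ w = dec ⟨K, a, (p'.1, p'.2, c)⟩ w) → p = p') :
    ∀ τ ∈ fibre kmem (HIndex.termSet I) K k, ∀ τ' ∈ fibre kmem (HIndex.termSet I) K k,
      sliceOf I τ = sliceOf I τ' → (∀ w ∈ k, dec τ w = dec τ' w) → τ = τ' := by
  intro τ hτ τ' hτ' hs hd
  obtain ⟨a, h, l, c, -, rfl⟩ := eq_of_mem_termSet (mem_fibre.1 hτ).1
  obtain ⟨a', h', l', c', -, rfl⟩ := eq_of_mem_termSet (mem_fibre.1 hτ').1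
  rw [sliceOf_eq_iff] at hs
  obtain ⟨rfl, rfl⟩ := hs
  have := hp a c (h, l) (h', l') hτ hτ' hd
  cases this
  rfl

/-! ## §2 THE JUNCTIONS ON M2-A's INDEX: (ρ) with `slice := sliceOf`, `Csl := CslOf` -/

variable {γ δ' δ β : Type*} [DecidableEq γ] [DecidableEq δ'] [DecidableEq β]

/-- **(ρ) `FibreMass` ON M2-A's INDEX, ANY CURRENCY** — the owner's `fibreMass_of_decoration` with the slice FIXED to
`sliceOf` and the slice set to `CslOf` (so `hsl` is gone) and the joint injectivity REDUCED to history pairs; `Dec`, `u`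
abstract (the custodian's weighted currency plugs in here; SPEC §2's `hρ_of_indexDecor` is this, field for field).
Conclusion LITERALLY `hρ`'s shape at one cutoff and class, `T := termSet I`. [folklore] -/
theorem fibreMass_of_decoration_idx (kmem : ℕ → HIndex.Idx I → Finset (γ × Gen PEv × δ')) (K : ℕ)
    (k : Finset (γ × Gen PEv × δ')) (dmass : HIndex.Idx I → ℝ) (φ : PEv → ℝ) {W : ℝ}
    (Dec : γ × Gen PEv × δ' → Finset δ) (dec : HIndex.Idx I → γ × Gen PEv × δ' → δ)
    {v : SIdx I → ℝ} (hv : ∀ s ∈ CslOf I kmem K k, 0 ≤ v s) (hW : ∑ s ∈ CslOf I kmem K k, v s ≤ W)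
    {u : γ × Gen PEv × δ' → δ → ℝ} (hu : ∀ w ∈ k, ∀ x ∈ Dec w, 0 ≤ u w x)
    (hmem : ∀ τ ∈ fibre kmem (HIndex.termSet I) K k, ∀ w ∈ k, dec τ w ∈ Dec w)
    (hinj : ∀ (a : (I K).Adm) (c : (I K).HC) (p p' : (I K).HZ × (I K).HL),
      (⟨K, a, (p.1, p.2, c)⟩ : HIndex.Idx I) ∈ fibre kmem (HIndex.termSet I) K k →
      (⟨K, a, (p'.1, p'.2, c)⟩ : HIndex.Idx I) ∈ fibre kmem (HIndex.termSet I) K k →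
      (∀ w ∈ k, dec ⟨K, a, (p.1, p.2, c)⟩ w = dec ⟨K, a, (p'.1, p'.2, c)⟩ w) → p = p')
    (hfac : ∀ τ ∈ fibre kmem (HIndex.termSet I) K k, dmass τ ≤ v (sliceOf I τ) * ∏ w ∈ k, u w (dec τ w))
    (hmass : ∀ w ∈ k, ∑ x ∈ Dec w, u w x ≤ Real.exp (nsum φ w.2.1)) :
    ∑ τ ∈ fibre kmem (HIndex.termSet I) K k, dmass τ ≤ W * MULTOf φ k :=
  fibreMass_of_decoration kmem (HIndex.termSet I) K k dmass φ Dec dec (CslOf I kmem K k) (sliceOf I) hv hW hu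
    (fun _ hτ => sliceOf_mem_CslOf hτ) hmem (hinj_of_histPair kmem K k dec hinj) hfac hmass


/-- **(ρ) `FibreMass` ON M2-A's INDEX FROM A GENEALOGY DECORATION, CRUDE CURRENCY, SLICE `:= sliceOf`** — the shape of
`HistReadDataL(W).hρ` at one cutoff `K`, source value (inside `dmass`, `v`) and class `k`, `T := termSet I`: remaining
hypotheses (ρ1) the displayed decoration `dec` with `hmem` and the REDUCED injectivity on history pairs; (ρ2) the slice
envelope over the slices met in the fibre and `dmass τ ≤ v (sliceOf τ)`; (ρ3)'s letters on the members' events.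
[folklore] -/
theorem fibreMass_of_genDecoration_idx (kmem : ℕ → HIndex.Idx I → Finset (γ × Gen PEv × δ')) (K : ℕ)
    (k : Finset (γ × Gen PEv × δ')) (dmass : HIndex.Idx I → ℝ) (φ : PEv → ℝ) {W : ℝ}
    (C : γ × Gen PEv × δ' → PEv → Finset β) (dec : HIndex.Idx I → γ × Gen PEv × δ' → Gen (PEv × β))
    {v : SIdx I → ℝ} (hv : ∀ s ∈ CslOf I kmem K k, 0 ≤ v s) (hW : ∑ s ∈ CslOf I kmem K k, v s ≤ W)
    (hmem : ∀ τ ∈ fibre kmem (HIndex.termSet I) K k, ∀ w ∈ k, dec τ w ∈ decG (C w) w.2.1)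
    (hinj : ∀ (a : (I K).Adm) (c : (I K).HC) (p p' : (I K).HZ × (I K).HL),
      (⟨K, a, (p.1, p.2, c)⟩ : HIndex.Idx I) ∈ fibre kmem (HIndex.termSet I) K k →
      (⟨K, a, (p'.1, p'.2, c)⟩ : HIndex.Idx I) ∈ fibre kmem (HIndex.termSet I) K k →
      (∀ w ∈ k, dec ⟨K, a, (p.1, p.2, c)⟩ w = dec ⟨K, a, (p'.1, p'.2, c)⟩ w) → p = p')
    (hfac : ∀ τ ∈ fibre kmem (HIndex.termSet I) K k, dmass τ ≤ v (sliceOf I τ))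
    (hC : ∀ w ∈ k, ∀ e ∈ w.2.1.events, ((C w e).card : ℝ) ≤ Real.exp (φ e)) :
    ∑ τ ∈ fibre kmem (HIndex.termSet I) K k, dmass τ ≤ W * MULTOf φ k :=
  fibreMass_of_genDecoration kmem (HIndex.termSet I) K k dmass φ C dec (CslOf I kmem K k) (sliceOf I) hv hW
    (fun _ hτ => sliceOf_mem_CslOf hτ) hmem (hinj_of_histPair kmem K k dec hinj) hfac hC

/-- **(ρ) `FibreMass` ON M2-A's INDEX FROM A GENEALOGY DECORATION, WEIGHTED CURRENCY, SLICE `:= sliceOf`** — part 2's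
`fibreMass_of_genDecorationW` with the slice fixed and the injectivity reduced to history pairs. [folklore] -/
theorem fibreMass_of_genDecorationW_idx (kmem : ℕ → HIndex.Idx I → Finset (γ × Gen PEv × δ')) (K : ℕ)
    (k : Finset (γ × Gen PEv × δ')) (dmass : HIndex.Idx I → ℝ) (φ : PEv → ℝ) {W : ℝ}
    (C : γ × Gen PEv × δ' → PEv → Finset β) (μ : γ × Gen PEv × δ' → PEv × β → ℝ)
    (dec : HIndex.Idx I → γ × Gen PEv × δ' → Gen (PEv × β))
    {v : SIdx I → ℝ} (hv : ∀ s ∈ CslOf I kmem K k, 0 ≤ v s) (hW : ∑ s ∈ CslOf I kmem K k, v s ≤ W)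
    (hmem : ∀ τ ∈ fibre kmem (HIndex.termSet I) K k, ∀ w ∈ k, dec τ w ∈ decG (C w) w.2.1)
    (hinj : ∀ (a : (I K).Adm) (c : (I K).HC) (p p' : (I K).HZ × (I K).HL),
      (⟨K, a, (p.1, p.2, c)⟩ : HIndex.Idx I) ∈ fibre kmem (HIndex.termSet I) K k →
      (⟨K, a, (p'.1, p'.2, c)⟩ : HIndex.Idx I) ∈ fibre kmem (HIndex.termSet I) K k →
      (∀ w ∈ k, dec ⟨K, a, (p.1, p.2, c)⟩ w = dec ⟨K, a, (p'.1, p'.2, c)⟩ w) → p = p')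
    (hfac : ∀ τ ∈ fibre kmem (HIndex.termSet I) K k,
      dmass τ ≤ v (sliceOf I τ) * ∏ w ∈ k, nmass (μ w) (dec τ w))
    (h0 : ∀ w ∈ k, ∀ e ∈ w.2.1.events, ∀ x ∈ C w e, 0 ≤ μ w (e, x))
    (hC : ∀ w ∈ k, ∀ e ∈ w.2.1.events, ∑ x ∈ C w e, μ w (e, x) ≤ Real.exp (φ e)) :
    ∑ τ ∈ fibre kmem (HIndex.termSet I) K k, dmass τ ≤ W * MULTOf φ k :=
  fibreMass_of_genDecorationW kmem (HIndex.termSet I) K k dmass φ C μ dec (CslOf I kmem K k) (sliceOf I) hv hW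
    (fun _ hτ => sliceOf_mem_CslOf hτ) hmem (hinj_of_histPair kmem K k dec hinj) hfac h0 hC

end Index
end

end Summit.QuantumFields.BalabanUV.T4Continuum.HistoryBankingFibreDecorSlice
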